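import Summits.ResolutionOfSingularities.ResolutionOfSingularities.Theorems.EquisingularLiftEquisingularLiftNatCISmoothingPoint
import Summits.ResolutionOfSingularities.ResolutionOfSingularities.Theorems.EquisingularLiftEquisingularLiftNatPlanarSmoothingLetter
import Summits.ResolutionOfSingularities.ResolutionOfSingularities.Theorems.EquisingularLiftEquisingularLiftNatCompleteIntersectionLiftJacobian
import Literature.AlgebraicGeometry.Resolution.RegularLocalRingsQuotient
import HarnessLib

/-!
# [OURS · L1 W4.5(b) · EL♮(3) · D11 «Σ5a ci-DIRECT» SUPPLY «ci_trace_smoothing», part 2d′] LETTER OF ANY DEGREE: «`ϖ` IS A REGULAR PARAMETER OF THE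
# HOST MODULO THE LETTER», THE LETTER IS REGULAR OVER THE POINT, AND THE JACOBIAN INPUT (HOST-J)

res-L1-w45b-stub-2 g19 (STUB WORKER 2), desk RULING R72a (iii).  OURS; NOT a statement of any manuscript ([Hironaka2017] is a candidate under
adjudication — nothing of it is asserted here); AI-written, weaker than expert review.  No `sorry`; standard axioms; DEF-FREE.
`--supports stmt-ResolutionOfSingularities-20148 --as helper`, counted 0.  EL♮(3) is NOT proved; resolution in positive characteristic is NOT proved.

WHAT.  `O` a DVR with uniformiser `ϖ`, `θ : O → k` with `θ ϖ = 0`, `φ = map θ`, `g = Proj φ : ℙⁿ_k → ℙⁿ_O`, `y ∈ D₊(x_d)`, `x = g y`, a form `L̃ ∈ 𝔭_x` of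
degree `d₁` with letter `𝓛 = (L̃)~`, and the HOST INPUT «the chart germ `Θ_y (φ L̃)` is NOT in `𝔪_y²`» (the reduction `V₊(φ L̃)` is smooth at `y`).
* `germ_notMem_sq_of_pderiv_notMem` — (HOST-J) ⇒ the host input: if some `∂_i (φ L̃) ∉ 𝔭_y` then `Θ_y (φ L̃) ∉ 𝔪_y²` (✓ `CILift.downstairs_stalk_of_jacobian`
  with one form, Matsumura 30.4).
* `isRegularLocalRing_letter_stalk_of_germ_notMem_sq` — host input + `𝒪_{ℙⁿ_O, x}` regular ⇒ `V(𝓛)` is regular at the point over `x` (`Θ_x L̃ ∉ 𝔪_x²`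
  by the local stalk map, then Matsumura 14.2 ✓ `IsRegularLocalRing.quotient_span_singleton`).
* ★ `germ_C_varpi_notMem_stalkIdeal_sup_sq_deg` — host input ⇒ `Θ_x ϖ ∉ 𝓛_x + 𝔪_x²` (part 2d's proof with `1 ↦ d₁`, the regularity of the reduced
  trace replaced by the host input it was only used to derive).
References (method / index only): H. Matsumura, *Commutative Ring Theory* (1986), Thm. 14.2, 30.4; R. Hartshorne, *Algebraic Geometry* (1977), II Prop. 5.9.
-/

set_option linter.dupNamespace false -- mandated namespace `Summit.<Summit>.<Problem>` of this single-conjunct summit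
set_option linter.overlappingInstances false -- signatures carry `[IsDomain O] [IsDiscreteValuationRing O]`

noncomputable section

open CategoryTheory AlgebraicGeometry TopologicalSpace IsLocalRing
open MvPolynomial HomogeneousLocalization
open Literature.AlgebraicGeometry.Resolution
open AlgebraicGeometry.Scheme.IdealSheafData

namespace Summit.ResolutionOfSingularities.ResolutionOfSingularities.Cruxes.EquisingularLiftNat.Sections.PlanarSmoothing

open Summit.ResolutionOfSingularities.ResolutionOfSingularities.Cruxes.EquisingularLiftNat.Sections
open Summit.ResolutionOfSingularities.ResolutionOfSingularities.Cruxes.EquisingularLiftNat.Sections.Equinodal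

/-! ## (HOST-J) ⇒ the chart germ of the reduced letter is a regular parameter -/

/-- If some partial derivative of a form `f ∈ 𝔭_y` does not vanish at `y ∈ D₊(x_d) ⊂ ℙⁿ_k`, the chart germ `f / x_d^{d₁}` is not in `𝔪_y²`.
[cite: Matsumura1987, Thm. 30.4] -/
theorem germ_notMem_sq_of_pderiv_notMem {k : Type} [Field k] {n : ℕ} (d : Fin (n + 1)) (d₁ : ℕ) (f : MvPolynomial (Fin (n + 1)) k)
    (hf : f ∈ homogeneousSubmodule (Fin (n + 1)) k d₁) :
    letI := MvPolynomial.gradedAlgebra (σ := Fin (n + 1)) (R := k)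
    ∀ (y : Proj (homogeneousSubmodule (Fin (n + 1)) k)) (hy : y ∈ Proj.basicOpen (homogeneousSubmodule (Fin (n + 1)) k) (X d)),
    f ∈ y.asHomogeneousIdeal → (∃ i : Fin (n + 1), pderiv i f ∉ y.asHomogeneousIdeal) →
    ((Proj (homogeneousSubmodule (Fin (n + 1)) k)).presheaf.germ (Proj.basicOpen (homogeneousSubmodule (Fin (n + 1)) k) (X d)) y hy).hom
        ((Proj.awayToSection (homogeneousSubmodule (Fin (n + 1)) k) (X d)).hom
          (mk₁ (homogeneousSubmodule (Fin (n + 1)) k) (CILift.X_mem_one' d) d₁ f hf)) ∉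
      maximalIdeal ((Proj (homogeneousSubmodule (Fin (n + 1)) k)).presheaf.stalk y) ^ 2 := by
  classical
  letI := MvPolynomial.gradedAlgebra (σ := Fin (n + 1)) (R := k)
  intro y hy hfy hjac hsq
  obtain ⟨i, hi⟩ := hjac
  have hjac' : ∃ e : Fin 1 ↪ Fin (n + 1), (Matrix.of fun a b : Fin 1 => pderiv (e b) ((![f] : Fin 1 → _) a)).det ∉ y.asHomogeneousIdeal := by
    refine ⟨⟨fun _ => i, fun a b _ => Subsingleton.elim a b⟩, ?_⟩
    rw [Matrix.det_unique]
    exact hi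
  have h := CILift.downstairs_stalk_of_jacobian (![f]) (![d₁]) (fun l => by fin_cases l; exact hf) y (fun l => by fin_cases l; exact hfy)
    hjac' d hy (fun _ => 1) (by rw [Fin.sum_univ_one, one_mul]; exact hsq) 0
  exact (maximalIdeal.isMaximal _).ne_top (Ideal.eq_top_of_isUnit_mem _ h isUnit_one)

/-! ## The letter is regular over the point -/

variable {O : Type} [CommRing O] [IsDomain O] [IsDiscreteValuationRing O] {ϖ : O} {n : ℕ}

omit [IsDomain O] [IsDiscreteValuationRing O] in
set_option maxHeartbeats 800000 in -- stalk-ideal computation along `g = Proj φ`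
/-- **`V((L̃)~)` is regular at the point over `x = g y`** when `𝒪_{ℙⁿ_O, x}` is regular and the reduction's chart germ `Θ_y (φ L̃)` is not in `𝔪_y²`:
`Θ_x L̃ ∉ 𝔪_x²` along the local stalk map of `g`, then Matsumura 14.2. [cite: Matsumura1987, Thm. 14.2] -/
theorem isRegularLocalRing_letter_stalk_of_germ_notMem_sq {k : Type} [Field k] (θ : O →+* k) (d : Fin (n + 1)) :
    letI := MvPolynomial.gradedAlgebra (σ := Fin (n + 1)) (R := O)
    letI := MvPolynomial.gradedAlgebra (σ := Fin (n + 1)) (R := k)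
    ∀ (φ : homogeneousSubmodule (Fin (n + 1)) O →+*ᵍ homogeneousSubmodule (Fin (n + 1)) k)
    (hφ' : HomogeneousIdeal.irrelevant (homogeneousSubmodule (Fin (n + 1)) k) ≤
      (HomogeneousIdeal.irrelevant (homogeneousSubmodule (Fin (n + 1)) O)).map φ), (∀ s, φ s = MvPolynomial.map θ s) →
    ∀ (y : Proj (homogeneousSubmodule (Fin (n + 1)) k)) (hy : y ∈ Proj.basicOpen (homogeneousSubmodule (Fin (n + 1)) k) (X d))
      (hx : Proj.map φ hφ' y ∈ Proj.basicOpen (homogeneousSubmodule (Fin (n + 1)) O) (X d)),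
    IsRegularLocalRing ((Proj (homogeneousSubmodule (Fin (n + 1)) O)).presheaf.stalk (Proj.map φ hφ' y)) →
    ∀ (d₁ : ℕ) (Lt : MvPolynomial (Fin (n + 1)) O) (hLt : Lt ∈ homogeneousSubmodule (Fin (n + 1)) O d₁),
    Lt ∈ (Proj.map φ hφ' y).asHomogeneousIdeal →
    ((Proj (homogeneousSubmodule (Fin (n + 1)) k)).presheaf.germ (Proj.basicOpen (homogeneousSubmodule (Fin (n + 1)) k) (X d)) y hy).hom
        ((Proj.awayToSection (homogeneousSubmodule (Fin (n + 1)) k) (X d)).hom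
          (mk₁ (homogeneousSubmodule (Fin (n + 1)) k) (CILift.X_mem_one' d) d₁ (φ Lt) (φ.map_mem hLt))) ∉
      maximalIdeal ((Proj (homogeneousSubmodule (Fin (n + 1)) k)).presheaf.stalk y) ^ 2 →
    ∀ x' : ↥(projIdealSheaf (homogeneousSubmodule (Fin (n + 1)) O) ⟨Ideal.span (Set.range ![Lt]),
        isHomogeneous_span_of_forall_mem _ _ _ (single_mem_deg Lt hLt)⟩).subscheme,
      (projIdealSheaf (homogeneousSubmodule (Fin (n + 1)) O) ⟨Ideal.span (Set.range ![Lt]),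
        isHomogeneous_span_of_forall_mem _ _ _ (single_mem_deg Lt hLt)⟩).subschemeι x' = Proj.map φ hφ' y →
      IsRegularLocalRing ((projIdealSheaf (homogeneousSubmodule (Fin (n + 1)) O) ⟨Ideal.span (Set.range ![Lt]),
        isHomogeneous_span_of_forall_mem _ _ _ (single_mem_deg Lt hLt)⟩).subscheme.presheaf.stalk x') := by
  classical
  letI := MvPolynomial.gradedAlgebra (σ := Fin (n + 1)) (R := O)
  letI := MvPolynomial.gradedAlgebra (σ := Fin (n + 1)) (R := k)
  intro φ hφ' hφ y hy hx hxreg d₁ Lt hLt hLtx hnot2 x' hx'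
  haveI := hxreg
  have hφX : φ (X d) = X d := by rw [hφ, map_X]
  have hφLt : (φ Lt : MvPolynomial (Fin (n + 1)) k) ∈ homogeneousSubmodule (Fin (n + 1)) k d₁ := φ.map_mem hLt
  let π := ((Proj.map φ hφ').stalkMap y).hom
  haveI : IsLocalHom π := inferInstanceAs (IsLocalHom ((Proj.map φ hφ').stalkMap y).hom)
  have hπLt : π (((Proj (homogeneousSubmodule (Fin (n + 1)) O)).presheaf.germ (Proj.basicOpen (homogeneousSubmodule (Fin (n + 1)) O) (X d))
        (Proj.map φ hφ' y) hx).hom ((Proj.awayToSection (homogeneousSubmodule (Fin (n + 1)) O) (X d)).hom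
          (mk₁ (homogeneousSubmodule (Fin (n + 1)) O) (CILift.X_mem_one' d) d₁ Lt hLt))) =
      ((Proj (homogeneousSubmodule (Fin (n + 1)) k)).presheaf.germ (Proj.basicOpen (homogeneousSubmodule (Fin (n + 1)) k) (X d)) y hy).hom
        ((Proj.awayToSection (homogeneousSubmodule (Fin (n + 1)) k) (X d)).hom
          (mk₁ (homogeneousSubmodule (Fin (n + 1)) k) (CILift.X_mem_one' d) d₁ (φ Lt) hφLt)) :=
    CILift.stalkMap_germ_mk₁ O φ hφ' d hφX d₁ Lt hLt (φ Lt) hφLt rfl y hy hx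
  have hnotx := notMem_ker_sup_sq_of_map_notMem_sq π (by rw [hπLt]; exact hnot2)
  have hnotx2 : ((Proj (homogeneousSubmodule (Fin (n + 1)) O)).presheaf.germ (Proj.basicOpen (homogeneousSubmodule (Fin (n + 1)) O) (X d))
        (Proj.map φ hφ' y) hx).hom ((Proj.awayToSection (homogeneousSubmodule (Fin (n + 1)) O) (X d)).hom
          (mk₁ (homogeneousSubmodule (Fin (n + 1)) O) (CILift.X_mem_one' d) d₁ Lt hLt)) ∉
      maximalIdeal ((Proj (homogeneousSubmodule (Fin (n + 1)) O)).presheaf.stalk (Proj.map φ hφ' y)) ^ 2 :=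
    fun h => hnotx (Ideal.mem_sup_right h)
  have hstalkL : stalkIdeal (projIdealSheaf (homogeneousSubmodule (Fin (n + 1)) O) ⟨Ideal.span (Set.range ![Lt]),
      isHomogeneous_span_of_forall_mem _ _ _ (single_mem_deg Lt hLt)⟩) (Proj.map φ hφ' y) =
      Ideal.span {((Proj (homogeneousSubmodule (Fin (n + 1)) O)).presheaf.germ (Proj.basicOpen (homogeneousSubmodule (Fin (n + 1)) O) (X d))
        (Proj.map φ hφ' y) hx).hom ((Proj.awayToSection (homogeneousSubmodule (Fin (n + 1)) O) (X d)).hom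
          (mk₁ (homogeneousSubmodule (Fin (n + 1)) O) (CILift.X_mem_one' d) d₁ Lt hLt))} := by
    rw [CILift.stalkIdeal_projIdealSheaf_span (![Lt]) (![d₁]) (single_mem_deg Lt hLt) d (Proj.map φ hφ' y) hx, Set.range_unique]
    rfl
  refine (isRegularLocalRing_subscheme_stalk_iff_of_eq _ x' _ hx').mpr ?_
  rw [hstalkL]
  exact (IsRegularLocalRing.quotient_span_singleton (germ_mk₁_mem_maximalIdeal_of_mem d d₁ Lt hLt (Proj.map φ hφ' y) hx hLtx) hnotx2).1

/-! ## `Θ_x ϖ ∉ 𝓛_x + 𝔪_x²`, letter of any degree -/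

set_option maxHeartbeats 800000 in -- stalk-ideal computations along the closed immersion `g = Proj φ`
/-- ★ **`ϖ` is a regular parameter of `𝒪_{ℙⁿ_O, x}` modulo the letter `𝓛 = (L̃)~` (`L̃` of any degree `d₁`), at a special-fibre point `x = g y`
where the reduction `φ L̃` is a regular parameter of `𝒪_{ℙⁿ_k, y}`.**  See the module docstring.  [cite: Matsumura1987, Thm. 14.2] [OURS · Σ5a supply part 2d′] -/
theorem germ_C_varpi_notMem_stalkIdeal_sup_sq_deg (hϖ : Irreducible ϖ) {k : Type} [Field k] (θ : O →+* k) (hθϖ : θ ϖ = 0) (d : Fin (n + 1)) :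
    letI := MvPolynomial.gradedAlgebra (σ := Fin (n + 1)) (R := O)
    letI := MvPolynomial.gradedAlgebra (σ := Fin (n + 1)) (R := k)
    ∀ (φ : homogeneousSubmodule (Fin (n + 1)) O →+*ᵍ homogeneousSubmodule (Fin (n + 1)) k)
    (hφ' : HomogeneousIdeal.irrelevant (homogeneousSubmodule (Fin (n + 1)) k) ≤
      (HomogeneousIdeal.irrelevant (homogeneousSubmodule (Fin (n + 1)) O)).map φ), (∀ s, φ s = MvPolynomial.map θ s) →
    ∀ (y : Proj (homogeneousSubmodule (Fin (n + 1)) k)) (hy : y ∈ Proj.basicOpen (homogeneousSubmodule (Fin (n + 1)) k) (X d))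
      (hx : Proj.map φ hφ' y ∈ Proj.basicOpen (homogeneousSubmodule (Fin (n + 1)) O) (X d)),
    ∀ (d₁ : ℕ) (Lt : MvPolynomial (Fin (n + 1)) O) (hLt : Lt ∈ homogeneousSubmodule (Fin (n + 1)) O d₁),
    Lt ∈ (Proj.map φ hφ' y).asHomogeneousIdeal →
    ((Proj (homogeneousSubmodule (Fin (n + 1)) k)).presheaf.germ (Proj.basicOpen (homogeneousSubmodule (Fin (n + 1)) k) (X d)) y hy).hom
        ((Proj.awayToSection (homogeneousSubmodule (Fin (n + 1)) k) (X d)).hom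
          (mk₁ (homogeneousSubmodule (Fin (n + 1)) k) (CILift.X_mem_one' d) d₁ (φ Lt) (φ.map_mem hLt))) ∉
      maximalIdeal ((Proj (homogeneousSubmodule (Fin (n + 1)) k)).presheaf.stalk y) ^ 2 →
    ((Proj (homogeneousSubmodule (Fin (n + 1)) O)).presheaf.germ (Proj.basicOpen (homogeneousSubmodule (Fin (n + 1)) O) (X d)) (Proj.map φ hφ' y) hx).hom
        ((Proj.awayToSection (homogeneousSubmodule (Fin (n + 1)) O) (X d)).hom
          (mk₁ (homogeneousSubmodule (Fin (n + 1)) O) (CILift.X_mem_one' d) 0 (C ϖ) (isHomogeneous_C _ ϖ))) ∉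
      stalkIdeal (projIdealSheaf (homogeneousSubmodule (Fin (n + 1)) O) ⟨Ideal.span (Set.range ![Lt]),
          isHomogeneous_span_of_forall_mem _ _ _ (single_mem_deg Lt hLt)⟩) (Proj.map φ hφ' y) ⊔
        maximalIdeal ((Proj (homogeneousSubmodule (Fin (n + 1)) O)).presheaf.stalk (Proj.map φ hφ' y)) ^ 2 := by
  classical
  letI := MvPolynomial.gradedAlgebra (σ := Fin (n + 1)) (R := O)
  letI := MvPolynomial.gradedAlgebra (σ := Fin (n + 1)) (R := k)
  intro φ hφ' hφ y hy hx d₁ Lt hLt hLtx hnot2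
  haveI : y.asHomogeneousIdeal.toIdeal.IsPrime := y.isPrime
  -- the coefficient map on the letters
  have hφX : φ (X d) = X d := by rw [hφ, map_X]
  have hφLt : (φ Lt : MvPolynomial (Fin (n + 1)) k) ∈ homogeneousSubmodule (Fin (n + 1)) k d₁ := φ.map_mem hLt
  have hφϖ : (φ (C ϖ) : MvPolynomial (Fin (n + 1)) k) = 0 := by rw [hφ, map_C, hθϖ, C_0]
  have hxϖ : (C ϖ : MvPolynomial (Fin (n + 1)) O) ∈ (Proj.map φ hφ' y).asHomogeneousIdeal := by
    change φ (C ϖ) ∈ y.asHomogeneousIdeal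
    rw [hφϖ]; exact zero_mem _
  -- the stalk map of `g = Proj φ` at `y` on the chart germs
  let π := ((Proj.map φ hφ').stalkMap y).hom
  have hπLt : π (((Proj (homogeneousSubmodule (Fin (n + 1)) O)).presheaf.germ (Proj.basicOpen (homogeneousSubmodule (Fin (n + 1)) O) (X d))
        (Proj.map φ hφ' y) hx).hom ((Proj.awayToSection (homogeneousSubmodule (Fin (n + 1)) O) (X d)).hom
          (mk₁ (homogeneousSubmodule (Fin (n + 1)) O) (CILift.X_mem_one' d) d₁ Lt hLt))) =
      ((Proj (homogeneousSubmodule (Fin (n + 1)) k)).presheaf.germ (Proj.basicOpen (homogeneousSubmodule (Fin (n + 1)) k) (X d)) y hy).hom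
        ((Proj.awayToSection (homogeneousSubmodule (Fin (n + 1)) k) (X d)).hom
          (mk₁ (homogeneousSubmodule (Fin (n + 1)) k) (CILift.X_mem_one' d) d₁ (φ Lt) hφLt)) :=
    CILift.stalkMap_germ_mk₁ O φ hφ' d hφX d₁ Lt hLt (φ Lt) hφLt rfl y hy hx
  have hπϖ : π (((Proj (homogeneousSubmodule (Fin (n + 1)) O)).presheaf.germ (Proj.basicOpen (homogeneousSubmodule (Fin (n + 1)) O) (X d))
        (Proj.map φ hφ' y) hx).hom ((Proj.awayToSection (homogeneousSubmodule (Fin (n + 1)) O) (X d)).hom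
          (mk₁ (homogeneousSubmodule (Fin (n + 1)) O) (CILift.X_mem_one' d) 0 (C ϖ) (isHomogeneous_C _ ϖ)))) = 0 := by
    have h := CILift.stalkMap_germ_mk₁ O φ hφ' d hφX 0 (C ϖ) (isHomogeneous_C _ ϖ) 0 (zero_mem _) hφϖ y hy hx
    rw [mk₁_zero, map_zero, map_zero] at h
    exact h
  -- `𝓛_x = (Θ_x L̃)` and `E_y = (Θ_y (φ L̃))`
  have hstalkL : stalkIdeal (projIdealSheaf (homogeneousSubmodule (Fin (n + 1)) O) ⟨Ideal.span (Set.range ![Lt]),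
      isHomogeneous_span_of_forall_mem _ _ _ (single_mem_deg Lt hLt)⟩) (Proj.map φ hφ' y) =
      Ideal.span {((Proj (homogeneousSubmodule (Fin (n + 1)) O)).presheaf.germ (Proj.basicOpen (homogeneousSubmodule (Fin (n + 1)) O) (X d))
        (Proj.map φ hφ' y) hx).hom ((Proj.awayToSection (homogeneousSubmodule (Fin (n + 1)) O) (X d)).hom
          (mk₁ (homogeneousSubmodule (Fin (n + 1)) O) (CILift.X_mem_one' d) d₁ Lt hLt))} := by
    rw [CILift.stalkIdeal_projIdealSheaf_span (![Lt]) (![d₁]) (single_mem_deg Lt hLt) d (Proj.map φ hφ' y) hx, Set.range_unique]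
    rfl
  -- pull back along `π`: `Θ_x L̃ ∉ ker π + 𝔪_x² ⊇ (Θ_x ϖ) + 𝔪_x²`
  haveI : IsLocalHom π := inferInstanceAs (IsLocalHom ((Proj.map φ hφ').stalkMap y).hom)
  have hnotx := notMem_ker_sup_sq_of_map_notMem_sq π (by rw [hπLt]; exact hnot2)
  have hle : Ideal.span {((Proj (homogeneousSubmodule (Fin (n + 1)) O)).presheaf.germ (Proj.basicOpen (homogeneousSubmodule (Fin (n + 1)) O) (X d))
        (Proj.map φ hφ' y) hx).hom ((Proj.awayToSection (homogeneousSubmodule (Fin (n + 1)) O) (X d)).hom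
          (mk₁ (homogeneousSubmodule (Fin (n + 1)) O) (CILift.X_mem_one' d) 0 (C ϖ) (isHomogeneous_C _ ϖ)))} ⊔
        maximalIdeal ((Proj (homogeneousSubmodule (Fin (n + 1)) O)).presheaf.stalk (Proj.map φ hφ' y)) ^ 2 ≤
      RingHom.ker π ⊔ maximalIdeal ((Proj (homogeneousSubmodule (Fin (n + 1)) O)).presheaf.stalk (Proj.map φ hφ' y)) ^ 2 :=
    sup_le_sup_right ((Ideal.span_singleton_le_iff_mem _).mpr (by rw [RingHom.mem_ker]; exact hπϖ)) _
  -- the symmetric trick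
  rw [hstalkL]
  exact notMem_span_sup_sq_symm (germ_C_varpi_notMem_sq hϖ d (Proj.map φ hφ' y) hx hxϖ)
    (germ_mk₁_mem_maximalIdeal_of_mem d d₁ Lt hLt (Proj.map φ hφ' y) hx hLtx) (fun h => hnotx (hle h))

end Summit.ResolutionOfSingularities.ResolutionOfSingularities.Cruxes.EquisingularLiftNat.Sections.PlanarSmoothing

end
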